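import Summits.ValiantsHypothesis.ValiantsHypothesis.Theorems.KPlusLogSqLawTropicalBExchangeSector
import Summits.ValiantsHypothesis.ValiantsHypothesis.Theorems.KPlusLogSqLawTropicalBNormalForm

/-!
# Route «KPlusLogSqLaw», crux `TropicalB` (stmt-ValiantsHypothesis-19771) — the EXCHANGE SECTOR, part 5:
# the linear law for UNSORTED exponents, and the crux's inequality with `C = 2` on the sector

HONEST FRAMING.  Helper toward the registered stubs `stub_tropThin` / `stub_tropFat` of `Cruxes/TropicalB/Lines/birth.lean` (crux
`Summit.ValiantsHypothesis.ValiantsHypothesis.Theses.KPlusLogSqLaw.TropicalB`, item stmt-ValiantsHypothesis-19771, route KPlusLogSqLaw,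
DRAFT; cell `pub-symmetroid`, seat val-sym-trop-p1 g9, 2026-08-27; `--supports … --as helper`).  Continuation of parts 1–4
(`…TropicalBExchangeStage` / `…Sector` / `…Carries` / `…Separable`).  A SECTOR theorem; nothing here bounds `TropicalB` for general designs,
and nothing bears on `WeakLifting`, DoorA26 / DoorA34, `MatrixDescartes` (stmt-ValiantsHypothesis-18050) or VP ≠ VNP.

* `exchange_relabelClasses` — the term-level exchange axiom (M-EXC) is invariant under relabelling the slope classes (it speaks of class
  COUNTS and valuation sums only);
* `chain_le_of_exchange_unsorted` — hence the law of part 2 WITHOUT the sorting hypothesis `Monotone d`: for EVERY design `(d, v, ε)` whose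
  present terms satisfy (M-EXC), every chain of unique optima at strictly increasing integer slopes with distinct consecutive terms has
  `n ≤ m·(K−1)` (sort the classes by `Tuple.sort`, transport the chain by `TropicalCensus.chain_relabel_classes` of `…TropicalBNormalForm`);
  `alternating_chain_le_of_exchange_unsorted` — the sign-alternating form (hypothesis list of `TropicalCensus.TropRootLawAt`);
* `exchange_kPlusLogSq` — bookkeeping: `m·(K−1) ≤ 2^(2(K + ⌊log₂ m⌋²))`, so on the exchange sector the crux's inequality holds with `C = 2`
  at every format (as for the arithmetic-progression row and the class-uniform row of the census).
[kernel arguments: this file; (M-EXC): Murota, Discrete Convex Analysis (2003), Ch. 6]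
-/

set_option linter.dupNamespace false
set_option autoImplicit false

namespace Summit.ValiantsHypothesis.ValiantsHypothesis.Theorems.KPlusLogSqLaw.ExchangeSector

open Summit.ValiantsHypothesis.ValiantsHypothesis.Theorems.MatrixDescartes.Negative
open Summit.ValiantsHypothesis.ValiantsHypothesis.Theorems.LacunarySymmetroidMatrixDescartes
open Summit.ValiantsHypothesis.ValiantsHypothesis.Theorems.LacunarySymmetroidMatrixDescartes.TropicalCensus
open scoped BigOperators
open Finset

variable {m K : ℕ}

/-! ## 1. Relabelling the classes preserves the exchange axiom -/

/-- class counts under relabelling: the count of class `π l` in `π ∘ κ` is the count of `l` in `κ`. [folklore] -/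
theorem card_class_comp_perm (π : Equiv.Perm (Fin K)) (κ : Fin m → Fin K) (l : Fin K) :
    (univ.filter fun b => (π ∘ κ) b = π l).card = (univ.filter fun b => κ b = l).card := by
  congr 1
  ext b
  simp only [mem_filter, mem_univ, true_and, Function.comp_apply, EmbeddingLike.apply_eq_iff_eq]

/-- class counts under relabelling, inverse form: the count of `l` in `π⁻¹ ∘ μ` is the count of `π l` in `μ`. [folklore] -/
theorem card_class_symm_comp (π : Equiv.Perm (Fin K)) (μ : Fin m → Fin K) (l : Fin K) :
    (univ.filter fun b => (π.symm ∘ μ) b = l).card = (univ.filter fun b => μ b = π l).card := by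
  congr 1
  ext b
  simp only [mem_filter, mem_univ, true_and, Function.comp_apply, Equiv.symm_apply_eq]

/-- **(M-EXC) is invariant under relabelling the classes.**  If the present terms of `(v, ε)` satisfy the term-level exchange axiom,
so do those of the relabelled design `(v ∘ π, ε ∘ π)` (classes renamed by `π`). [this file] -/
theorem exchange_relabelClasses (π : Equiv.Perm (Fin K)) (v ε : Fin m → Fin m → Fin K → ℤ)
    (hex : ∀ p q : Equiv.Perm (Fin m) × (Fin m → Fin K), termSign ε p ≠ 0 → termSign ε q ≠ 0 →
      ∀ i : Fin K, (univ.filter fun b => q.2 b = i).card < (univ.filter fun b => p.2 b = i).card →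
        ∃ j : Fin K, (univ.filter fun b => p.2 b = j).card < (univ.filter fun b => q.2 b = j).card ∧
          ∃ p' q' : Equiv.Perm (Fin m) × (Fin m → Fin K), termSign ε p' ≠ 0 ∧ termSign ε q' ≠ 0 ∧
            (∀ l, (univ.filter fun b => p'.2 b = l).card + (if l = i then 1 else 0) =
              (univ.filter fun b => p.2 b = l).card + (if l = j then 1 else 0)) ∧
            (∀ l, (univ.filter fun b => q'.2 b = l).card + (if l = j then 1 else 0) =
              (univ.filter fun b => q.2 b = l).card + (if l = i then 1 else 0)) ∧
            (∑ b, v (p'.1 b) b (p'.2 b)) + (∑ b, v (q'.1 b) b (q'.2 b)) ≤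
              (∑ b, v (p.1 b) b (p.2 b)) + (∑ b, v (q.1 b) b (q.2 b))) :
    ∀ p q : Equiv.Perm (Fin m) × (Fin m → Fin K),
      termSign (fun a b l => ε a b (π l)) p ≠ 0 → termSign (fun a b l => ε a b (π l)) q ≠ 0 →
      ∀ i : Fin K, (univ.filter fun b => q.2 b = i).card < (univ.filter fun b => p.2 b = i).card →
        ∃ j : Fin K, (univ.filter fun b => p.2 b = j).card < (univ.filter fun b => q.2 b = j).card ∧
          ∃ p' q' : Equiv.Perm (Fin m) × (Fin m → Fin K),
            termSign (fun a b l => ε a b (π l)) p' ≠ 0 ∧ termSign (fun a b l => ε a b (π l)) q' ≠ 0 ∧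
            (∀ l, (univ.filter fun b => p'.2 b = l).card + (if l = i then 1 else 0) =
              (univ.filter fun b => p.2 b = l).card + (if l = j then 1 else 0)) ∧
            (∀ l, (univ.filter fun b => q'.2 b = l).card + (if l = j then 1 else 0) =
              (univ.filter fun b => q.2 b = l).card + (if l = i then 1 else 0)) ∧
            (∑ b, v (p'.1 b) b (π (p'.2 b))) + (∑ b, v (q'.1 b) b (π (q'.2 b))) ≤
              (∑ b, v (p.1 b) b (π (p.2 b))) + (∑ b, v (q.1 b) b (π (q.2 b))) := by
  classical
  rintro ⟨σ, κ⟩ ⟨τ, ν⟩ hp hq i hi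
  rw [termSign_relabelClasses] at hp hq
  -- the original design sees the terms `(σ, π ∘ κ)`, `(τ, π ∘ ν)` and the class `π i`
  have hi' : (univ.filter fun b => (π ∘ ν) b = π i).card < (univ.filter fun b => (π ∘ κ) b = π i).card := by
    rw [card_class_comp_perm, card_class_comp_perm]; exact hi
  obtain ⟨j₀, hj₀, x, y, hx, hy, hcx, hcy, hV⟩ := hex (σ, π ∘ κ) (τ, π ∘ ν) hp hq (π i) hi'
  refine ⟨π.symm j₀, ?_, (x.1, π.symm ∘ x.2), (y.1, π.symm ∘ y.2), ?_, ?_, ?_, ?_, ?_⟩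
  · have h1 := card_class_comp_perm π κ (π.symm j₀)
    have h2 := card_class_comp_perm π ν (π.symm j₀)
    rw [Equiv.apply_symm_apply] at h1 h2
    simp only at hj₀
    rw [← h1, ← h2]; exact hj₀
  · rw [termSign_relabelClasses]
    have e : (π : Fin K → Fin K) ∘ (π.symm ∘ x.2) = x.2 := by funext b; simp
    rw [e]; exact hx
  · rw [termSign_relabelClasses]
    have e : (π : Fin K → Fin K) ∘ (π.symm ∘ y.2) = y.2 := by funext b; simp
    rw [e]; exact hy
  · intro l
    have h := hcx (π l)
    simp only at h ⊢
    rw [card_class_symm_comp, ← card_class_comp_perm π κ l]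
    have e1 : (if π l = π i then 1 else 0 : ℕ) = (if l = i then 1 else 0 : ℕ) := by
      simp only [EmbeddingLike.apply_eq_iff_eq]
    have e2 : (if π l = j₀ then 1 else 0 : ℕ) = (if l = π.symm j₀ then 1 else 0 : ℕ) := by
      simp only [Equiv.apply_eq_iff_eq_symm_apply]
    rw [← e1, ← e2]; exact h
  · intro l
    have h := hcy (π l)
    simp only at h ⊢
    rw [card_class_symm_comp, ← card_class_comp_perm π ν l]
    have e1 : (if π l = π i then 1 else 0 : ℕ) = (if l = i then 1 else 0 : ℕ) := by
      simp only [EmbeddingLike.apply_eq_iff_eq]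
    have e2 : (if π l = j₀ then 1 else 0 : ℕ) = (if l = π.symm j₀ then 1 else 0 : ℕ) := by
      simp only [Equiv.apply_eq_iff_eq_symm_apply]
    rw [← e1, ← e2]; exact h
  · simp only [Function.comp_apply, Equiv.apply_symm_apply] at hV ⊢
    exact hV

/-! ## 2. The linear law without the sorting hypothesis -/

/-- **THE EXCHANGE SECTOR IS LINEAR (unsorted exponents).**  For EVERY design `(d, v, ε)` whose present terms satisfy the term-level
exchange axiom (M-EXC), every chain of unique optima at strictly increasing integer slopes with distinct consecutive terms has
`n ≤ m·(K−1)`.  (Part 2's `chain_le_of_exchange` after sorting the classes by `Tuple.sort d`.) [this file] -/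
theorem chain_le_of_exchange_unsorted (d : Fin K → ℕ) (v ε : Fin m → Fin m → Fin K → ℤ)
    (hex : ∀ p q : Equiv.Perm (Fin m) × (Fin m → Fin K), termSign ε p ≠ 0 → termSign ε q ≠ 0 →
      ∀ i : Fin K, (univ.filter fun b => q.2 b = i).card < (univ.filter fun b => p.2 b = i).card →
        ∃ j : Fin K, (univ.filter fun b => p.2 b = j).card < (univ.filter fun b => q.2 b = j).card ∧
          ∃ p' q' : Equiv.Perm (Fin m) × (Fin m → Fin K), termSign ε p' ≠ 0 ∧ termSign ε q' ≠ 0 ∧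
            (∀ l, (univ.filter fun b => p'.2 b = l).card + (if l = i then 1 else 0) =
              (univ.filter fun b => p.2 b = l).card + (if l = j then 1 else 0)) ∧
            (∀ l, (univ.filter fun b => q'.2 b = l).card + (if l = j then 1 else 0) =
              (univ.filter fun b => q.2 b = l).card + (if l = i then 1 else 0)) ∧
            (∑ b, v (p'.1 b) b (p'.2 b)) + (∑ b, v (q'.1 b) b (q'.2 b)) ≤
              (∑ b, v (p.1 b) b (p.2 b)) + (∑ b, v (q.1 b) b (q.2 b)))
    {n : ℕ} (θ : Fin (n + 1) → ℤ) (p : Fin (n + 1) → Equiv.Perm (Fin m) × (Fin m → Fin K))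
    (hθ : StrictMono θ) (hdom : ∀ k, IsDominant d v ε (θ k) (p k))
    (hne : ∀ k : Fin n, p k.castSucc ≠ p k.succ) : n ≤ m * (K - 1) := by
  classical
  set π : Equiv.Perm (Fin K) := Tuple.sort d with hπ
  have hmono : Monotone (d ∘ π) := by rw [hπ]; exact Tuple.monotone_sort d
  obtain ⟨hdom', -⟩ := chain_relabel_classes π d v ε θ p hdom
  have hne' : ∀ k : Fin n, ((p k.castSucc).1, π.symm ∘ (p k.castSucc).2) ≠ ((p k.succ).1, π.symm ∘ (p k.succ).2) := by
    intro k h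
    apply hne k
    have h1 := congrArg Prod.fst h
    have h2 := congrArg Prod.snd h
    simp only at h1 h2
    refine Prod.ext h1 ?_
    funext b
    have := congrFun h2 b
    simpa using this
  have hex' := exchange_relabelClasses π v ε hex
  exact chain_le_of_exchange (d ∘ π) hmono (fun a b l => v a b (π l)) (fun a b l => ε a b (π l)) hex' θ
    (fun k => ((p k).1, π.symm ∘ (p k).2)) hθ hdom' hne'

/-- **Sign-alternating form, unsorted exponents** (hypothesis list of `TropicalCensus.TropRootLawAt`). [this file] -/
theorem alternating_chain_le_of_exchange_unsorted (d : Fin K → ℕ) (v ε : Fin m → Fin m → Fin K → ℤ)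
    (hex : ∀ p q : Equiv.Perm (Fin m) × (Fin m → Fin K), termSign ε p ≠ 0 → termSign ε q ≠ 0 →
      ∀ i : Fin K, (univ.filter fun b => q.2 b = i).card < (univ.filter fun b => p.2 b = i).card →
        ∃ j : Fin K, (univ.filter fun b => p.2 b = j).card < (univ.filter fun b => q.2 b = j).card ∧
          ∃ p' q' : Equiv.Perm (Fin m) × (Fin m → Fin K), termSign ε p' ≠ 0 ∧ termSign ε q' ≠ 0 ∧
            (∀ l, (univ.filter fun b => p'.2 b = l).card + (if l = i then 1 else 0) =
              (univ.filter fun b => p.2 b = l).card + (if l = j then 1 else 0)) ∧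
            (∀ l, (univ.filter fun b => q'.2 b = l).card + (if l = j then 1 else 0) =
              (univ.filter fun b => q.2 b = l).card + (if l = i then 1 else 0)) ∧
            (∑ b, v (p'.1 b) b (p'.2 b)) + (∑ b, v (q'.1 b) b (q'.2 b)) ≤
              (∑ b, v (p.1 b) b (p.2 b)) + (∑ b, v (q.1 b) b (q.2 b)))
    {n : ℕ} (θ : Fin (n + 1) → ℤ) (p : Fin (n + 1) → Equiv.Perm (Fin m) × (Fin m → Fin K))
    (hθ : StrictMono θ) (hdom : ∀ k, IsDominant d v ε (θ k) (p k))
    (halt : ∀ k : Fin n, termSign ε (p k.castSucc) * termSign ε (p k.succ) < 0) : n ≤ m * (K - 1) := by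
  refine chain_le_of_exchange_unsorted d v ε hex θ p hθ hdom fun k h => ?_
  have := halt k
  rw [h] at this
  exact absurd this (not_lt.mpr (mul_self_nonneg _))

/-! ## 3. The crux's inequality with `C = 2` on the sector -/

/-- arithmetic: `m·(K−1) ≤ 2^(2(K + ⌊log₂ m⌋²))`. [folklore] -/
theorem mul_pred_le_two_pow (m K : ℕ) : m * (K - 1) ≤ 2 ^ (2 * (K + Nat.log 2 m ^ 2)) := by
  rcases Nat.eq_zero_or_pos K with rfl | hK
  · simp
  have hm : m < 2 ^ (Nat.log 2 m + 1) := Nat.lt_pow_succ_log_self (by norm_num) m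
  have hK' : K - 1 < 2 ^ K := lt_of_le_of_lt (Nat.sub_le K 1) Nat.lt_two_pow_self
  have hL : Nat.log 2 m ≤ Nat.log 2 m ^ 2 := Nat.le_self_pow two_ne_zero _
  calc m * (K - 1) ≤ 2 ^ (Nat.log 2 m + 1) * 2 ^ K := Nat.mul_le_mul hm.le hK'.le
    _ = 2 ^ (Nat.log 2 m + 1 + K) := (pow_add 2 _ _).symm
    _ ≤ 2 ^ (2 * (K + Nat.log 2 m ^ 2)) := Nat.pow_le_pow_right (by norm_num) (by omega)

/-- **`TropicalB`'s inequality with `C = 2` on the exchange sector** (every format, every exponent vector): a design whose present terms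
satisfy (M-EXC) has all its sign-alternating dominant chains of length `n ≤ 2^(2(K + ⌊log₂ m⌋²))`. [this file] -/
theorem exchange_kPlusLogSq (d : Fin K → ℕ) (v ε : Fin m → Fin m → Fin K → ℤ)
    (hex : ∀ p q : Equiv.Perm (Fin m) × (Fin m → Fin K), termSign ε p ≠ 0 → termSign ε q ≠ 0 →
      ∀ i : Fin K, (univ.filter fun b => q.2 b = i).card < (univ.filter fun b => p.2 b = i).card →
        ∃ j : Fin K, (univ.filter fun b => p.2 b = j).card < (univ.filter fun b => q.2 b = j).card ∧
          ∃ p' q' : Equiv.Perm (Fin m) × (Fin m → Fin K), termSign ε p' ≠ 0 ∧ termSign ε q' ≠ 0 ∧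
            (∀ l, (univ.filter fun b => p'.2 b = l).card + (if l = i then 1 else 0) =
              (univ.filter fun b => p.2 b = l).card + (if l = j then 1 else 0)) ∧
            (∀ l, (univ.filter fun b => q'.2 b = l).card + (if l = j then 1 else 0) =
              (univ.filter fun b => q.2 b = l).card + (if l = i then 1 else 0)) ∧
            (∑ b, v (p'.1 b) b (p'.2 b)) + (∑ b, v (q'.1 b) b (q'.2 b)) ≤
              (∑ b, v (p.1 b) b (p.2 b)) + (∑ b, v (q.1 b) b (q.2 b)))
    {n : ℕ} (θ : Fin (n + 1) → ℤ) (p : Fin (n + 1) → Equiv.Perm (Fin m) × (Fin m → Fin K))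
    (hθ : StrictMono θ) (hdom : ∀ k, IsDominant d v ε (θ k) (p k))
    (halt : ∀ k : Fin n, termSign ε (p k.castSucc) * termSign ε (p k.succ) < 0) :
    n ≤ 2 ^ (2 * (K + Nat.log 2 m ^ 2)) :=
  (alternating_chain_le_of_exchange_unsorted d v ε hex θ p hθ hdom halt).trans (mul_pred_le_two_pow m K)

end Summit.ValiantsHypothesis.ValiantsHypothesis.Theorems.KPlusLogSqLaw.ExchangeSector
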